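import Mathlib
import Literature.MathematicalPhysics.QuantumFieldTheory.UniformTorusClusteringProofs
import Literature.MathematicalPhysics.QuantumFieldTheory.LatticeGaugeProofs
import Literature.MathematicalPhysics.QuantumLattice.ContinuumLimitLGT
import Summits.Ventures.LatticeQCDFlow.Scaling.ConjecturesRepaired
import Summits.Ventures.LatticeQCDFlow.Scaling.TruncatedCorrelatorFloor

/-!
# LatticeQCDFlow / Scaling — the BRIDGE from the leading-coefficient identity (LC) to the
# venture's cross-cut correlator floor (U′) at strong coupling (item 121; sharpening of item 120)

HONEST FRAMING: exact (Metropolis-corrected) sampling algorithms for lattice gauge theory;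
figures of merit are autocorrelation/cost numbers at stated couplings and volumes; no
continuum-physics claim.

Venture `LatticeQCDFlow` (cell pub-lqcd), topic `Scaling`, item 121 of HOME/THEORY-2.md §3.1 (hx) /
§4 row T2-AL (v4.8).  Item 120 (`Scaling.TruncatedCorrelatorFloor`) proved: IF the complex truncated
torus expectation `torusTruncC ρ (L+1) F₁ F₂ v` of two bounded local observables has leading Taylor
term `b βⁿ` at `β = 0` with ONE `b ≠ 0` and ONE `n` for every `L ∈ good` (hypothesis (LC)), THEN one
`β₀ > 0` gives the floor `|b| |β|ⁿ / 2` under the truncated torus Wilson expectation of the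
PERIODISED observables `toTorusObservable (L+1) F₁`, `toTorusObservable (L+1) (F₂ ∘ configShift v)`
for all real `|β| ≤ β₀` and all `L ∈ good`.  The venture's typed hypothesis
`Conjectures.CrossCutCorrelatorFloor d N G ρ β R i j a` (v2.3, (U′)) is phrased differently: torus
plaquette observables `U ↦ Re tr ρ(U_p)` at an ARBITRARY base point `x : Site d L` and at
`x + (2R+1)·e_a`, every torus side `L ≥ L₀` (with `[NeZero L]`).  This file closes the gap, with no
physics input:
* `toTorusObservable_plaquetteObs`, `toTorusObservable_plaquetteObs_comp_configShift`,
  `toTorusObservable_plaquetteObs_mul` — periodisation identities: the `ℤ^d` plaquette observable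
  `plaquetteObs ρ x i j` read through the periodic lift `torusLift L` IS the torus plaquette
  observable at `Torus.proj L x`, and `configShift v` moves it to `Torus.proj L (x − v)`
  (cf. the tree's `plaquette_torusLift`, `plaquetteHolonomyZd_configShift`);
* `torusProj_neg_single_natCast` — `Torus.proj L (−m·e_a) = −m·e_a` (`m : ℕ`);
* `wilsonExpectation_plaquettePair_base` (+ the two one-plaquette versions),
  `wilsonTruncatedPair_comm` — torus translation invariance
  (`wilsonExpectation_comp_torusConfigShift` [cite: OsterwalderSeilerAnnPhys1978, §2]) moves the
  base point of a plaquette pair from `y` to `0`; the two factors of a truncated pair commute;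
* `plaquette_truncated_floor_of_leadingCoeff` — (LC) for the pair of `(i,j)`-plaquettes at `0` and
  `−v` on the tori `L+1`, `L ∈ good` ⇒ ONE `β₀ > 0` with
  `|b| |β|ⁿ/2 ≤ |⟨P_y P_{y+π(−v)}⟩_{L+1,β} − ⟨P_y⟩⟨P_{y+π(−v)}⟩|` for all real `|β| ≤ β₀`, all
  `L ∈ good` and ALL base points `y : Site d (L+1)`;
* `crossCutCorrelatorFloor_of_leadingCoeff` — (LC) with `v := (2R+1)·e_a` for all `L ≥ L₀` ⇒
  `∃ β₀ > 0, ∀ β, β ≠ 0 → |β| ≤ β₀ → Conjectures.CrossCutCorrelatorFloor d N G ρ β R i j a`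
  (the sign of `v` is immaterial: translation by `(2R+1)·e_a` and commutativity of the product swap
  the two plaquettes); `crossCutCorrelatorFloorR_of_leadingCoeff` — the same for the repaired item
  `CrossCutCorrelatorFloorR` (v2.5).
CONSEQUENCE (the cell's assembled chain, THEORY-2.md §3.1): once the successor proves (LC) — a
β-free, volume-combinatorial identity about the `β = 0` jet (for two parallel plaquettes stacked at
distance `t = 2R+1` along `a ∉ {i,j}`, `d ≥ 3`: `n = 4t`, `b = 2^{-(4t+1)} N^{-4t}` for `U(1)`,
`N = 1`, and `SU(N)`, `N ≥ 3` [cite: MontvayMunster1994, §3.6.2 eq. (3.437)], [cite: Schor1984,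
Thm 3.1–3.2]) — the volume law `Barriers.VolumeScalingOfTraining` / `Barriers.ReceptiveFieldLaw`
holds at every strong coupling `0 < β ≤ β₀` with NO physics hypothesis, through
`Theory2.defectFromCorrelation` (T2-N).  What is NOT proved here: (LC) itself (successor's target,
recorded verbatim in HOME/lean/theory2/LANDING.md §32–§33).  LITERATURE GRADE (honest): known
mechanism (Osterwalder–Seiler analyticity and translation invariance of the torus Wilson state);
new = kernel-checked glue typing item 120 against the venture's (U′) exactly as declared.

References: K. Osterwalder, E. Seiler, Ann. Phys. 110 (1978) 440, §2–3
[OsterwalderSeilerAnnPhys1978]; E. Seiler, LNP 159 (1982) Ch. 2–3 [SeilerLNP1982]; I. Montvay,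
G. Münster, *Quantum Fields on a Lattice* (1994) §3.6.2 [MontvayMunster1994]; R. Schor, Commun.
Math. Phys. 92 (1984) 369–395 [Schor1984].  Elementary given the tree; farm `lean check` rc 0, no
`sorry`.
-/

noncomputable section

open MeasureTheory Filter Asymptotics Finset
open scoped Topology
open Literature.MathematicalPhysics.QuantumFieldTheory
open Literature.MathematicalPhysics.QuantumLattice (configShift configShift_apply toTorusObservable
  toTorusObservable_apply plaquetteObs plaquetteHolonomyZd torusLift torusEdge
  originPlaquetteSupport
  isCylinder_plaquetteObs_zero measurable_plaquetteObs exists_abs_plaquetteObs_le)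
open Literature.Probability.LatticeModels (Torus.proj Torus.proj_apply)

namespace Summit.Ventures.LatticeQCDFlow.Theory2

variable {d N : ℕ} {G : Type} [Group G]

/-! ## 1. Periodisation identities for plaquette observables -/

section Periodisation

variable (ρ : G →* Matrix (Fin N) (Fin N) ℂ)

omit [Group G] in
/-- `Torus.proj L (−m·e_a) = −m·e_a` on the torus (`m : ℕ`). [folklore] -/
theorem torusProj_neg_single_natCast (L : ℕ) (a : Fin d) (m : ℕ) :
    (Torus.proj L (-Pi.single a (m : ℤ)) : Site d L) = -Pi.single a (m : ZMod L) := by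
  funext k
  by_cases hk : k = a
  · subst hk; simp [Torus.proj_apply]
  · simp [Torus.proj_apply, hk]

/-- Periodisation of a plaquette observable: `plaquetteObs ρ x i j` read through the periodic lift
is the torus plaquette observable at `Torus.proj L x`. [folklore] -/
theorem toTorusObservable_plaquetteObs (L : ℕ) (x : Literature.Probability.LatticeModels.Site d)
    (i j : Fin d) :
    toTorusObservable L (plaquetteObs (G := G) ρ x i j) =
      fun U : GaugeConfig d L G => (ρ (plaquetteHolonomy U (Torus.proj L x) i j)).trace.re := by
  funext U
  simp only [toTorusObservable_apply, plaquetteObs, plaquetteHolonomyZd, plaquetteHolonomy,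
    torusLift,
    torusEdge, Function.comp_apply, torusProj_site_add_single]

variable [MeasurableSpace G]

/-- Periodisation of a shifted plaquette observable: `plaquetteObs ρ x i j ∘ configShift v` read
through the periodic lift is the torus plaquette observable at `Torus.proj L (x − v)`. [folklore] -/
theorem toTorusObservable_plaquetteObs_comp_configShift (L : ℕ)
    (v x : Literature.Probability.LatticeModels.Site d) (i j : Fin d) :
    toTorusObservable L (plaquetteObs (G := G) ρ x i j ∘ configShift v) =
      fun U : GaugeConfig d L G =>
        (ρ (plaquetteHolonomy U (Torus.proj L (x - v)) i j)).trace.re := by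
  funext U
  simp only [toTorusObservable_apply, Function.comp_apply, plaquetteObs, plaquetteHolonomyZd,
    plaquetteHolonomy, configShift_apply, torusLift, torusEdge, add_sub_right_comm,
    torusProj_site_add_single]

/-- Periodisation of the product of a plaquette observable and a shifted one. [folklore] -/
theorem toTorusObservable_plaquetteObs_mul (L : ℕ)
    (v x₁ x₂ : Literature.Probability.LatticeModels.Site d) (i₁ j₁ i₂ j₂ : Fin d) :
    toTorusObservable L (fun U => plaquetteObs (G := G) ρ x₁ i₁ j₁ U *
        plaquetteObs ρ x₂ i₂ j₂ (configShift v U)) =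
      fun U : GaugeConfig d L G =>
        (ρ (plaquetteHolonomy U (Torus.proj L x₁) i₁ j₁)).trace.re *
          (ρ (plaquetteHolonomy U (Torus.proj L (x₂ - v)) i₂ j₂)).trace.re := by
  funext U
  simp only [toTorusObservable_apply, Function.comp_apply, plaquetteObs, plaquetteHolonomyZd,
    plaquetteHolonomy, configShift_apply, torusLift, torusEdge, add_sub_right_comm,
    torusProj_site_add_single]

end Periodisation

/-! ## 2. Moving the base point of a plaquette pair (torus translation invariance) -/

section Translation

variable [TopologicalSpace G] [IsTopologicalGroup G] [CompactSpace G] [MeasurableSpace G]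
  [BorelSpace G] (ρ : G →* Matrix (Fin N) (Fin N) ℂ)

/-- Translation invariance of the one-plaquette expectation: base point `y` to `0`. [folklore] -/
theorem wilsonExpectation_plaquette_base {L : ℕ} [NeZero L] (β : ℝ) (y : Site d L)
    (i j : Fin d) :
    wilsonExpectation (L := L) ρ β (fun U => (ρ (plaquetteHolonomy U y i j)).trace.re) =
      wilsonExpectation (L := L) ρ β (fun U => (ρ (plaquetteHolonomy U 0 i j)).trace.re) := by
  rw [← wilsonExpectation_comp_torusConfigShift ρ β (-y)
    (fun U => (ρ (plaquetteHolonomy U 0 i j)).trace.re)]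
  congr 1
  funext U
  simp only [Function.comp_apply, plaquetteHolonomy_torusConfigShift, sub_neg_eq_add, zero_add]

/-- Translation invariance of the shifted one-plaquette expectation: base point `y + w` to `w`.
[folklore] -/
theorem wilsonExpectation_plaquette_base_add {L : ℕ} [NeZero L] (β : ℝ) (y w : Site d L)
    (i j : Fin d) :
    wilsonExpectation (L := L) ρ β (fun U => (ρ (plaquetteHolonomy U (y + w) i j)).trace.re) =
      wilsonExpectation (L := L) ρ β (fun U => (ρ (plaquetteHolonomy U w i j)).trace.re) := by
  rw [← wilsonExpectation_comp_torusConfigShift ρ β (-y)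
    (fun U => (ρ (plaquetteHolonomy U w i j)).trace.re)]
  congr 1
  funext U
  simp only [Function.comp_apply, plaquetteHolonomy_torusConfigShift, sub_neg_eq_add, add_comm y w]

/-- Translation invariance of the plaquette-pair expectation: base point `y` to `0`. [folklore] -/
theorem wilsonExpectation_plaquettePair_base {L : ℕ} [NeZero L] (β : ℝ) (y w : Site d L)
    (i₁ j₁ i₂ j₂ : Fin d) :
    wilsonExpectation (L := L) ρ β (fun U => (ρ (plaquetteHolonomy U y i₁ j₁)).trace.re *
        (ρ (plaquetteHolonomy U (y + w) i₂ j₂)).trace.re) =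
      wilsonExpectation (L := L) ρ β (fun U => (ρ (plaquetteHolonomy U 0 i₁ j₁)).trace.re *
        (ρ (plaquetteHolonomy U w i₂ j₂)).trace.re) := by
  rw [← wilsonExpectation_comp_torusConfigShift ρ β (-y)
    (fun U => (ρ (plaquetteHolonomy U 0 i₁ j₁)).trace.re *
      (ρ (plaquetteHolonomy U w i₂ j₂)).trace.re)]
  congr 1
  funext U
  simp only [Function.comp_apply, plaquetteHolonomy_torusConfigShift, sub_neg_eq_add, zero_add,
    add_comm y w]

/-- Swapping the two factors of a truncated pair expectation. [folklore] -/
theorem wilsonTruncatedPair_comm {L : ℕ} [NeZero L] (β : ℝ) (f g : GaugeConfig d L G → ℝ) :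
    wilsonExpectation (L := L) ρ β (fun U => f U * g U) -
        wilsonExpectation (L := L) ρ β f * wilsonExpectation (L := L) ρ β g =
      wilsonExpectation (L := L) ρ β (fun U => g U * f U) -
        wilsonExpectation (L := L) ρ β g * wilsonExpectation (L := L) ρ β f := by
  simp only [mul_comm]

end Translation

/-! ## 3. The bridge: (LC) ⇒ the plaquette-pair floor at every base point ⇒ (U′) -/

section Bridge

variable [TopologicalSpace G] [IsTopologicalGroup G] [CompactSpace G] [MeasurableSpace G]
  [BorelSpace G] [SecondCountableTopology G] (ρ : G →* Matrix (Fin N) (Fin N) ℂ)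

/-- **(LC) ⇒ the plaquette-pair floor at every base point.**  If on every torus `L+1`, `L ∈ good`,
the complex truncated expectation of the `(i,j)`-plaquettes at `0` and at `−v` has leading Taylor
term `b βⁿ` at `β = 0` with one `b ≠ 0` and one `n`, then ONE `β₀ > 0` gives, for every real
`|β| ≤ β₀`, every `L ∈ good` and every base point `y`,
`|b| |β|ⁿ / 2 ≤ |⟨P_y P_{y+π(−v)}⟩_{L+1,β} − ⟨P_y⟩_{L+1,β} ⟨P_{y+π(−v)}⟩_{L+1,β}|`. [folklore] -/
theorem plaquette_truncated_floor_of_leadingCoeff (hρ : Continuous ρ) (i j : Fin d)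
    (v : Literature.Probability.LatticeModels.Site d) {n : ℕ} {b : ℝ} (hb : b ≠ 0) (good : Set ℕ)
    (hLC : ∀ L ∈ good, (fun β : ℂ =>
        torusTruncC ρ (L + 1) (plaquetteObs ρ 0 i j) (plaquetteObs ρ 0 i j) v β - (b : ℂ) * β ^ n)
      =O[𝓝 (0 : ℂ)] fun β => β ^ (n + 1)) :
    ∃ β₀ : ℝ, 0 < β₀ ∧ ∀ L ∈ good, ∀ β : ℝ, |β| ≤ β₀ → ∀ y : Site d (L + 1),
      |b| * |β| ^ n / 2 ≤
        |wilsonExpectation (L := L + 1) ρ β (fun U => (ρ (plaquetteHolonomy U y i j)).trace.re *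
              (ρ (plaquetteHolonomy U (y + Torus.proj (L + 1) (-v)) i j)).trace.re) -
          wilsonExpectation (L := L + 1) ρ β (fun U => (ρ (plaquetteHolonomy U y i j)).trace.re) *
            wilsonExpectation (L := L + 1) ρ β
              (fun U => (ρ (plaquetteHolonomy U (y + Torus.proj (L + 1) (-v)) i j)).trace.re)| := by
  have hloc : Literature.MathematicalPhysics.QuantumLattice.IsLocalObservable
      (plaquetteObs (G := G) ρ 0 i j) :=
    ⟨originPlaquetteSupport i j, isCylinder_plaquetteObs_zero ρ i j⟩
  have hm : Measurable (plaquetteObs (G := G) ρ 0 i j) := measurable_plaquetteObs ρ hρ 0 i j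
  have hbd : ∃ C, ∀ U, |plaquetteObs (G := G) ρ 0 i j U| ≤ C :=
    exists_abs_plaquetteObs_le ρ hρ 0 i j
  obtain ⟨β₀, hβ₀, h⟩ :=
    torus_truncated_floor_of_leadingCoeff ρ hρ hloc hloc hm hm hbd hbd v hb good hLC
  refine ⟨β₀, hβ₀, fun L hL β hβ y => ?_⟩
  have key := h L hL β hβ
  rw [toTorusObservable_plaquetteObs_mul, toTorusObservable_plaquetteObs,
    toTorusObservable_plaquetteObs_comp_configShift] at key
  have h0 : (Torus.proj (L + 1) (0 : Literature.Probability.LatticeModels.Site d) : Site d (L + 1))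
      = 0 := by
    funext k; simp [Torus.proj_apply]
  rw [zero_sub, h0] at key
  rwa [wilsonExpectation_plaquettePair_base, wilsonExpectation_plaquette_base ρ β y,
    wilsonExpectation_plaquette_base_add]

/-- **The bridge (item 121): (LC) ⇒ (U′) at strong coupling.**  If for all `L ≥ L₀` the complex
truncated torus expectation on the torus `L+1` of the `(i,j)`-plaquette at `0` and its translate by
`configShift ((2R+1)·e_a)` has leading Taylor term `b βⁿ` at `β = 0` with one `b ≠ 0` and one `n`
(hypothesis (LC); for `a ∉ {i,j}`, `d ≥ 3`: `n = 4(2R+1)`, `b = 2^{-(4(2R+1)+1)} N^{-4(2R+1)}` for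
`U(1)` / `SU(N)`, `N ≥ 3` — the successor's target), then the venture's cross-cut correlator floor
`Conjectures.CrossCutCorrelatorFloor d N G ρ β R i j a` holds at EVERY real coupling
`0 < |β| ≤ β₀`, with one `β₀ > 0`. [folklore] -/
theorem crossCutCorrelatorFloor_of_leadingCoeff (hρ : Continuous ρ) (i j a : Fin d) (R : ℕ)
    {n : ℕ} {b : ℝ} (hb : b ≠ 0) (L₀ : ℕ)
    (hLC : ∀ L : ℕ, L₀ ≤ L → (fun β : ℂ =>
        torusTruncC ρ (L + 1) (plaquetteObs ρ 0 i j) (plaquetteObs ρ 0 i j)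
          (Pi.single a ((2 * R + 1 : ℕ) : ℤ)) β - (b : ℂ) * β ^ n)
      =O[𝓝 (0 : ℂ)] fun β => β ^ (n + 1)) :
    ∃ β₀ : ℝ, 0 < β₀ ∧ ∀ β : ℝ, β ≠ 0 → |β| ≤ β₀ →
      Conjectures.CrossCutCorrelatorFloor d N G ρ β R i j a := by
  obtain ⟨β₀, hβ₀, h⟩ := plaquette_truncated_floor_of_leadingCoeff ρ hρ i j
    (Pi.single a ((2 * R + 1 : ℕ) : ℤ)) hb {L | L₀ ≤ L} (fun L hL => hLC L hL)
  refine ⟨β₀, hβ₀, fun β hβ0 hβ => ⟨|b| * |β| ^ n / 2, ?_, L₀ + 1, ?_⟩⟩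
  · have hb' : 0 < |b| := abs_pos.2 hb
    have hβ' : 0 < |β| := abs_pos.2 hβ0
    positivity
  · intro L _ hL x
    obtain ⟨L', rfl⟩ : ∃ L', L = L' + 1 := Nat.exists_eq_add_one_of_ne_zero (NeZero.ne L)
    have hL' : L' ∈ {L | L₀ ≤ L} := by
      show L₀ ≤ L'
      omega
    have key := h L' hL' β hβ (x + Pi.single a ((2 * R + 1 : ℕ) : ZMod (L' + 1)))
    rw [torusProj_neg_single_natCast, add_neg_cancel_right] at key
    rw [wilsonTruncatedPair_comm ρ β]
    exact key

/-- **The bridge for the repaired item (U′-R)** `CrossCutCorrelatorFloorR` (v2.5): same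
hypothesis, conclusion at every real coupling `0 < |β| ≤ β₀`. [folklore] -/
theorem crossCutCorrelatorFloorR_of_leadingCoeff (hρ : Continuous ρ) (i j a : Fin d) (R : ℕ)
    {n : ℕ} {b : ℝ} (hb : b ≠ 0) (L₀ : ℕ)
    (hLC : ∀ L : ℕ, L₀ ≤ L → (fun β : ℂ =>
        torusTruncC ρ (L + 1) (plaquetteObs ρ 0 i j) (plaquetteObs ρ 0 i j)
          (Pi.single a ((2 * R + 1 : ℕ) : ℤ)) β - (b : ℂ) * β ^ n)
      =O[𝓝 (0 : ℂ)] fun β => β ^ (n + 1)) :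
    ∃ β₀ : ℝ, 0 < β₀ ∧ ∀ β : ℝ, β ≠ 0 → |β| ≤ β₀ →
      Conjectures.CrossCutCorrelatorFloorR d N G ρ β R i j a := by
  obtain ⟨β₀, hβ₀, h⟩ := crossCutCorrelatorFloor_of_leadingCoeff ρ hρ i j a R hb L₀ hLC
  exact ⟨β₀, hβ₀, fun β hβ0 hβ => Conjectures.crossCutCorrelatorFloorR_of (h β hβ0 hβ)⟩

end Bridge

end Summit.Ventures.LatticeQCDFlow.Theory2

end
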